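import Literature.AlgebraicGeometry.Resolution.RegularLocalRingsQuotient
import Mathlib.RingTheory.Nakayama
import Mathlib.Algebra.Module.SpanRank
import Mathlib.RingTheory.Ideal.Quotient.Operations
import Mathlib.RingTheory.LocalRing.RingHom.Basic
import HarnessLib

/-!
# `SigmaMaxModificationsCorridor3` (stmt-19249), line `tame_wild`: Step 2 of the QUADRIC GAP —
# the minimal regular presentation of a local ring

[OURS · L1 W4.2] Ring-level input of the scheme-level readings of the chain's helpers H1/H1′ (hypersurface
rigidity / Hilbert function of `S/(g)`, stated for a presentation `S ↠ A` by a regular local ring of the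
RIGHT dimension `dim S = emb.dim A`) and Step 2 of the quadric gap (`…Corridor3TameThreeOfQuadricGap`,
`…QuadricGapPrincipal`): **every quotient `A` of a regular local ring is the quotient of a regular local ring
of dimension `emb.dim A`** — cut the given `S` down along kernel elements outside `𝔪_S²`
(`IsRegularLocalRing.quotient_span_singleton`, Matsumura Thm. 14.2), which exist as long as
`emb.dim S > emb.dim A` (`exists_mem_ker_not_mem_sq`: lift minimal generators of `𝔪_A`; if the kernel were
inside `𝔪_S²` they would generate `𝔪_S` by Nakayama). NOT a statement of any manuscript.

* `exists_mem_ker_not_mem_sq` — `f : S ↠ A` local Noetherian, `emb.dim A < emb.dim S` ⇒ `∃ x ∈ ker f ∖ 𝔪_S²`;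
* `exists_regular_quotient_presentation` — `S` regular local, `f : S ↠ A` ⇒ there is an ideal `J ⊆ ker f`
  with `S ⧸ J` regular local of dimension `emb.dim A` (so `A` is a quotient of `S ⧸ J` by `Ideal.Quotient.lift`).

## Sources
* H. Matsumura, *Commutative Ring Theory* (1986), Thm. 14.2; Nakayama's lemma Thm. 2.2. [Matsumura1987]
-/

set_option linter.dupNamespace false -- mandated namespace of this single-conjunct summit

noncomputable section

open IsLocalRing Literature.AlgebraicGeometry.Resolution

namespace Summit.ResolutionOfSingularities.ResolutionOfSingularities.Theorems.SigmaMaxModificationsCorridor3.TameWild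

universe u

/-- A surjection of local rings maps `𝔪_S` into `𝔪_A` (it is a local homomorphism). [folklore] -/
theorem map_mem_maximalIdeal_of_surjective {S A : Type*} [CommRing S] [CommRing A] [IsLocalRing S]
    [IsLocalRing A] (f : S →+* A) (hf : Function.Surjective f) {y : S} (hy : y ∈ maximalIdeal S) :
    f y ∈ maximalIdeal A := by
  rw [← IsLocalRing.map_maximalIdeal_of_surjective f hf]
  exact Ideal.mem_map_of_mem f hy

/-- **If `f : S ↠ A` is a surjection of Noetherian local rings with `emb.dim A < emb.dim S`, some element
of `ker f` lies outside `𝔪_S²`.** Lift a minimal generating set `t` of `𝔪_A` to `u ⊆ 𝔪_S`; every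
`y ∈ 𝔪_S` is congruent to an element of `(u)` modulo `ker f`; if `ker f ⊆ 𝔪_S²`, Nakayama gives
`𝔪_S = (u)`, so `emb.dim S ≤ #u ≤ #t = emb.dim A`. [cite: Matsumura1987, Thm. 2.2 (Nakayama)] -/
theorem exists_mem_ker_not_mem_sq {S A : Type*} [CommRing S] [CommRing A] [IsLocalRing S]
    [IsNoetherianRing S] [IsLocalRing A] [IsNoetherianRing A] (f : S →+* A)
    (hf : Function.Surjective f) (hlt : (maximalIdeal A).spanFinrank < (maximalIdeal S).spanFinrank) :
    ∃ x ∈ RingHom.ker f, x ∉ maximalIdeal S ^ 2 := by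
  classical
  by_contra h
  simp only [not_exists, not_and, not_not] at h
  have hmA : (maximalIdeal A).FG := IsNoetherian.noetherian _
  obtain ⟨t, htcard, htspan⟩ := Submodule.FG.exists_span_finset_card_eq_spanFinrank hmA
  obtain ⟨s, hs⟩ : ∃ s : A → S, ∀ a, f (s a) = a := ⟨fun a => (hf a).choose, fun a => (hf a).choose_spec⟩
  set u : Finset S := t.image s with hu
  -- `f` maps `(u)` onto `𝔪_A`
  have hmapu : Ideal.map f (Ideal.span (↑u : Set S)) = maximalIdeal A := by
    rw [Ideal.map_span, hu, Finset.coe_image, ← Set.image_comp]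
    have hfs : ⇑f ∘ s = id := funext hs
    rw [hfs, Set.image_id]
    exact htspan
  -- `(u) ⊆ 𝔪_S`
  have hule : Ideal.span (↑u : Set S) ≤ maximalIdeal S := by
    rw [Ideal.span_le]
    intro x hx
    rw [hu, Finset.coe_image] at hx
    obtain ⟨a, ha, rfl⟩ := hx
    have ha' : a ∈ maximalIdeal A := by
      rw [← htspan]; exact Submodule.subset_span ha
    by_contra hunit
    have hsu : IsUnit (s a) := by
      by_contra h'
      exact hunit ((IsLocalRing.mem_maximalIdeal _).mpr h')
    exact (IsLocalRing.mem_maximalIdeal _).mp ha' (by simpa [hs a] using hsu.map f)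
  -- `𝔪_S ⊆ (u) + 𝔪_S²`
  have hle : maximalIdeal S ≤ Ideal.span (↑u : Set S) ⊔ maximalIdeal S • maximalIdeal S := by
    intro y hy
    have hfy : f y ∈ Ideal.map f (Ideal.span (↑u : Set S)) := by
      rw [hmapu]; exact map_mem_maximalIdeal_of_surjective f hf hy
    obtain ⟨x, hx, hfx⟩ := (Ideal.mem_map_iff_of_surjective f hf).mp hfy
    have hker : y - x ∈ RingHom.ker f := by
      rw [RingHom.mem_ker, map_sub, hfx, sub_self]
    have hsq : y - x ∈ maximalIdeal S ^ 2 := h _ hker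
    rw [smul_eq_mul, ← pow_two]
    have : y = x + (y - x) := by ring
    rw [this]
    exact Submodule.add_mem_sup hx hsq
  -- Nakayama: `𝔪_S = (u)`
  have hmS : maximalIdeal S ≤ Ideal.span (↑u : Set S) :=
    Submodule.le_of_le_smul_of_le_jacobson_bot (IsNoetherian.noetherian _)
      (IsLocalRing.maximalIdeal_le_jacobson ⊥) hle
  have heq : maximalIdeal S = Ideal.span (↑u : Set S) := le_antisymm hmS hule
  -- count generators
  have h1 : (maximalIdeal S).spanFinrank ≤ u.card := by
    rw [heq]
    have := Submodule.spanFinrank_span_le_ncard_of_finite (R := S) (M := S) (Finset.finite_toSet u)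
    simpa using this
  have h2 : u.card ≤ t.card := Finset.card_image_le
  omega

/-- **Minimal regular presentation.** If `A` is a quotient of a regular local ring `S` (`f : S ↠ A`), then
`A` is a quotient of a regular local ring of dimension `emb.dim A`: there is an ideal `J ⊆ ker f` of `S` with
`S ⧸ J` regular local and `dim (S ⧸ J) = emb.dim A`. Induction on `emb.dim S - emb.dim A`, cutting by one
element of `ker f ∖ 𝔪_S²` at a time (Matsumura Thm. 14.2). [cite: Matsumura1987, Thm. 14.2] -/
theorem exists_regular_quotient_presentation :
    ∀ (k : ℕ) (S : Type u) [CommRing S] [IsRegularLocalRing S] (A : Type u) [CommRing A]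
      [IsLocalRing A] [IsNoetherianRing A] (f : S →+* A), Function.Surjective f →
      (maximalIdeal S).spanFinrank = (maximalIdeal A).spanFinrank + k →
      ∃ J : Ideal S, J ≤ RingHom.ker f ∧ ∃ _ : IsRegularLocalRing (S ⧸ J),
        ringKrullDim (S ⧸ J) = ((maximalIdeal A).spanFinrank : WithBot ℕ∞) := by
  intro k
  induction k with
  | zero =>
    intro S _ _ A _ _ _ f hf hk
    refine ⟨⊥, bot_le, IsRegularLocalRing.of_ringEquiv (RingEquiv.quotientBot S).symm, ?_⟩
    rw [ringKrullDim_eq_of_ringEquiv (RingEquiv.quotientBot S), ← IsRegularLocalRing.spanFinrank_maximalIdeal,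
      hk, add_zero]
  | succ k ih =>
    intro S _ _ A _ _ _ f hf hk
    have hlt : (maximalIdeal A).spanFinrank < (maximalIdeal S).spanFinrank := by omega
    obtain ⟨x, hxker, hx2⟩ := exists_mem_ker_not_mem_sq f hf hlt
    have hxm : x ∈ maximalIdeal S := by
      by_contra hunit
      have hu : IsUnit x := by
        by_contra h'; exact hunit ((IsLocalRing.mem_maximalIdeal _).mpr h')
      have h0 : IsUnit (f x) := hu.map f
      rw [RingHom.mem_ker] at hxker
      rw [hxker] at h0
      exact not_isUnit_zero h0
    obtain ⟨hreg1, -⟩ := IsRegularLocalRing.quotient_span_singleton hxm hx2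
    have hemb := IsRegularLocalRing.spanFinrank_maximalIdeal_quotient_span_singleton hxm hx2
    -- the induced surjection `S ⧸ (x) ↠ A`
    set S₁ := S ⧸ Ideal.span {x} with hS₁
    have hle : Ideal.span {x} ≤ RingHom.ker f := by
      rw [Ideal.span_le, Set.singleton_subset_iff]; exact hxker
    let f₁ : S₁ →+* A := Ideal.Quotient.lift (Ideal.span {x}) f fun a ha => hle ha
    have hf₁ : Function.Surjective f₁ := by
      intro a
      obtain ⟨y, rfl⟩ := hf a
      exact ⟨Ideal.Quotient.mk _ y, rfl⟩
    have hemb' : (maximalIdeal S₁).spanFinrank + 1 = (maximalIdeal S).spanFinrank := hemb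
    have hk₁ : (maximalIdeal S₁).spanFinrank = (maximalIdeal A).spanFinrank + k := by omega
    obtain ⟨J₁, hJ₁, hregJ, hdimJ⟩ := ih S₁ A f₁ hf₁ hk₁
    -- pull back to `S`
    refine ⟨J₁.comap (Ideal.Quotient.mk (Ideal.span {x})), ?_, ?_⟩
    · intro y hy
      have h1 : Ideal.Quotient.mk (Ideal.span {x}) y ∈ RingHom.ker f₁ := hJ₁ hy
      rw [RingHom.mem_ker] at h1 ⊢
      exact h1
    · have hxJ : Ideal.span {x} ≤ J₁.comap (Ideal.Quotient.mk (Ideal.span {x})) := by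
        intro y hy
        rw [Ideal.mem_comap, Ideal.Quotient.eq_zero_iff_mem.mpr hy]
        exact J₁.zero_mem
      have hmap : J₁ = (J₁.comap (Ideal.Quotient.mk (Ideal.span {x}))).map
          (Ideal.Quotient.mk (Ideal.span {x})) :=
        (Ideal.map_comap_of_surjective _ Ideal.Quotient.mk_surjective J₁).symm
      let e : (S₁ ⧸ J₁) ≃+* S ⧸ J₁.comap (Ideal.Quotient.mk (Ideal.span {x})) :=
        (Ideal.quotEquivOfEq hmap).trans (DoubleQuot.quotQuotEquivQuotOfLE hxJ)
      refine ⟨IsRegularLocalRing.of_ringEquiv e, ?_⟩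
      rw [← ringKrullDim_eq_of_ringEquiv e]
      exact hdimJ

/-- **Minimal regular presentation, packaged:** a quotient `A` of a regular local ring `S` is a quotient of the
regular local ring `S ⧸ J` of dimension `emb.dim A`, for some `J ⊆ ker (S → A)`.
[cite: Matsumura1987, Thm. 14.2] -/
theorem exists_regular_quotient_presentation' {S : Type u} [CommRing S] [IsRegularLocalRing S]
    {A : Type u} [CommRing A] [IsLocalRing A] [IsNoetherianRing A] (f : S →+* A)
    (hf : Function.Surjective f) :
    ∃ J : Ideal S, J ≤ RingHom.ker f ∧ ∃ _ : IsRegularLocalRing (S ⧸ J),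
      ringKrullDim (S ⧸ J) = ((maximalIdeal A).spanFinrank : WithBot ℕ∞) := by
  -- `emb.dim A ≤ emb.dim S` (generators map to generators)
  have hle : (maximalIdeal A).spanFinrank ≤ (maximalIdeal S).spanFinrank := by
    have h := Ideal.spanFinrank_map_le_of_fg f (I := maximalIdeal S) (IsNoetherian.noetherian _)
    rwa [IsLocalRing.map_maximalIdeal_of_surjective f hf] at h
  obtain ⟨k, hk⟩ := Nat.exists_eq_add_of_le hle
  exact exists_regular_quotient_presentation k S A f hf hk

end Summit.ResolutionOfSingularities.ResolutionOfSingularities.Theorems.SigmaMaxModificationsCorridor3.TameWild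

end
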